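import Mathlib
import Summits.ValiantsHypothesis.ValiantsHypothesis.Theses.FreeFermionCLL

/-!
# Birth skeleton (BC3) for split piece `ColourMerging` of `PMCorrelationGap` — the AMPLIFICATION LINE

Piece (child 2 of the glued split `FreeFermionQPDecay → ColourMerging → PMCorrelationGap`,
crux-strategist seat `planner-cstrat-stmt-ValiantsHypothesis-13555-r1-0`): there are `A, C` such that
for all `n, R, K, κ` some read-once kernel `K'` on the board has
`permCorrSq(P^(n))^(A+1) ≤ C·(R+n+1)^C·permCorrSq(FF_{K'}^(n))`, `P = det(I_R + diag(x∘κ)K)`.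

Line (symmetrisation / amplification):
* `stub_amplify` — AMPLIFICATION BY SYMMETRISATION (provable in principle, size L): averaging `k`
  conjugates of `P` under the symmetry group of `per_n` (row/column permutations and the
  determinant-one torus twists `x_ij ↦ s_i t_j x_ij`, `∏ s_i ∏ t_j = 1`, which act unitarily on
  coefficient space, fix the permutation monomials and have no other invariant degree-`n`
  monomial) keeps the shape "principal-minor form of total rank `poly(k, R, n)`" (a sum of `k`
  determinants of size `R` is one determinant of polynomial size with value `1` at `0`, then the
  Sylvester normal form) and divides the squared norm of the junk part by `k` for a good choice
  of conjugates (second-moment method): `k·ρ·(1 − ρ̃) ≤ 1 − ρ` for the new correlation `ρ̃`;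
* `stub_goodCorrelatorsForceFF` — the COMPARISON FOR GOOD CORRELATORS (the open content): a
  total-rank-`R` form at angle `≤ 45°` from `per_n` forces a free-fermion kernel with overlap
  `≥ 1/(C (R+n+1)^C)`;
* `ColourMerging_of` — given `ρ > 0`, amplify with `k = ⌈2/ρ⌉` to a good correlator of rank
  `≤ (k(R+n+2))^B`, apply the comparison, and unwind: `ρ^(BC+1) ≤ C·3^(BC)·2^((B+1)C)·(R+n+1)^((B+1)C)·s`.
  PROVED below (no sorry outside the stubs); it shows in passing that the power `A` in the piece is
  exactly the price of amplification (`A = BC`).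

Neither stub is the piece, the parent or the summit (probes in the seat folder `bc/`):
`stub_amplify` is a structural lemma about principal-minor forms (no hardness content),
`stub_goodCorrelatorsForceFF` is the piece restricted to `ρ ≥ 1/2` (equivalent to the piece only
THROUGH `stub_amplify`, up to the power).
-/

set_option linter.dupNamespace false

namespace Summit.ValiantsHypothesis.ValiantsHypothesis.Theses.FreeFermionCLL

/-- The piece, verbatim as the split renders it (child 2 of `PMCorrelationGap`). Once the split is
enacted this local copy is replaced by the route-file decl of the same name. -/
def ColourMerging : Prop :=
  ∃ A C : ℕ, ∀ (n R : ℕ) (K : Matrix (Fin R) (Fin R) ℂ) (κ : Fin R → Fin n × Fin n), ∃ K' : Matrix (Fin n × Fin n) (Fin n × Fin n) ℂ, Literature.Computability.AlgebraicComplexity.permCorrSq n (MvPolynomial.homogeneousComponent n (1 + Matrix.diagonal (fun i => MvPolynomial.X (κ i)) * K.map (fun a : ℂ => (MvPolynomial.C a : MvPolynomial (Fin n × Fin n) ℂ))).det) ^ (A + 1) ≤ (C : ℝ) * ((R : ℝ) + n + 1) ^ C * Literature.Computability.AlgebraicComplexity.permCorrSq n (MvPolynomial.homogeneousComponent n (1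 + Matrix.diagonal (fun e : Fin n × Fin n => MvPolynomial.X e) * K'.map (fun a : ℂ => (MvPolynomial.C a : MvPolynomial (Fin n × Fin n) ℂ))).det)

end Summit.ValiantsHypothesis.ValiantsHypothesis.Theses.FreeFermionCLL

namespace Summit.ValiantsHypothesis.ValiantsHypothesis.Cruxes.PMCorrelationGap.AmplificationLine

open Literature.Computability.AlgebraicComplexity
open Summit.ValiantsHypothesis.ValiantsHypothesis.Theses.FreeFermionCLL

/-- The degree-`n` component of the coloured principal-minor form `det(I_R + diag(x∘κ)·K)`. -/
local notation "PM(" n ", " R ", " K ", " κ ")" =>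
  MvPolynomial.homogeneousComponent n
    (Matrix.det (1 + Matrix.diagonal (fun i : Fin R => MvPolynomial.X (κ i)) *
      Matrix.map K (fun a : ℂ => (MvPolynomial.C a : MvPolynomial (Fin n × Fin n) ℂ))))

/-- The degree-`n` component of the read-once (free-fermion) form with kernel `K'` on the board. -/
local notation "FF(" n ", " K ")" =>
  MvPolynomial.homogeneousComponent n
    (Matrix.det (1 + Matrix.diagonal (fun e : Fin n × Fin n => MvPolynomial.X e) *
      Matrix.map K (fun a : ℂ => (MvPolynomial.C a : MvPolynomial (Fin n × Fin n) ℂ))))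

/-- **stub (structural, size L)** — amplification by symmetrisation: from correlation `ρ` at total
rank `R`, for every `k ≥ 1` a form of total rank `≤ (k(R+n+2))^B` with `k·ρ·(1 − ρ̃) ≤ 1 − ρ`. -/
theorem stub_amplify :
    ∃ B : ℕ, ∀ (n R : ℕ) (K : Matrix (Fin R) (Fin R) ℂ) (κ : Fin R → Fin n × Fin n) (k : ℕ),
      1 ≤ k → ∃ R' : ℕ, R' ≤ (k * (R + n + 2)) ^ B ∧
        ∃ (K₁ : Matrix (Fin R') (Fin R') ℂ) (κ₁ : Fin R' → Fin n × Fin n),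
          (k : ℝ) * permCorrSq n (PM(n, R, K, κ)) * (1 - permCorrSq n (PM(n, R', K₁, κ₁))) ≤
            1 - permCorrSq n (PM(n, R, K, κ)) := by
  sorry

/-- **stub (hardest — the open content, size XL)** — good correlators force free-fermion overlap. -/
theorem stub_goodCorrelatorsForceFF :
    ∃ C : ℕ, ∀ (n R : ℕ) (K : Matrix (Fin R) (Fin R) ℂ) (κ : Fin R → Fin n × Fin n),
      (1 / 2 : ℝ) ≤ permCorrSq n (PM(n, R, K, κ)) →
        ∃ K' : Matrix (Fin n × Fin n) (Fin n × Fin n) ℂ,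
          (1 : ℝ) ≤ (C : ℝ) * ((R : ℝ) + n + 1) ^ C * permCorrSq n (FF(n, K')) := by
  sorry

/-- **Composition**: amplification + the comparison for good correlators imply the piece, with
power `A = B·C` and constant `C·3^(BC)·2^((B+1)C) + (B+1)C + 1`. -/
theorem ColourMerging_of
    (h₁ : ∃ B : ℕ, ∀ (n R : ℕ) (K : Matrix (Fin R) (Fin R) ℂ) (κ : Fin R → Fin n × Fin n) (k : ℕ),
      1 ≤ k → ∃ R' : ℕ, R' ≤ (k * (R + n + 2)) ^ B ∧
        ∃ (K₁ : Matrix (Fin R') (Fin R') ℂ) (κ₁ : Fin R' → Fin n × Fin n),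
          (k : ℝ) * permCorrSq n (PM(n, R, K, κ)) * (1 - permCorrSq n (PM(n, R', K₁, κ₁))) ≤
            1 - permCorrSq n (PM(n, R, K, κ)))
    (h₂ : ∃ C : ℕ, ∀ (n R : ℕ) (K : Matrix (Fin R) (Fin R) ℂ) (κ : Fin R → Fin n × Fin n),
      (1 / 2 : ℝ) ≤ permCorrSq n (PM(n, R, K, κ)) →
        ∃ K' : Matrix (Fin n × Fin n) (Fin n × Fin n) ℂ,
          (1 : ℝ) ≤ (C : ℝ) * ((R : ℝ) + n + 1) ^ C * permCorrSq n (FF(n, K'))) :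
    ColourMerging := by
  obtain ⟨B, hamp⟩ := h₁
  obtain ⟨C₁, hgood⟩ := h₂
  set C₀ : ℕ := C₁ * 3 ^ (B * C₁) * 2 ^ ((B + 1) * C₁) + (B + 1) * C₁ + 1 with hC₀
  refine ⟨B * C₁, C₀, fun n R K κ => ?_⟩
  set ρ : ℝ := permCorrSq n (PM(n, R, K, κ)) with hρ
  have hρ0 : 0 ≤ ρ := permCorrSq_nonneg _
  have hρ1 : ρ ≤ 1 := permCorrSq_le_one _
  have hbase1 : (1 : ℝ) ≤ (R : ℝ) + n + 1 := by
    have : (0 : ℝ) ≤ R := Nat.cast_nonneg R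
    have : (0 : ℝ) ≤ n := Nat.cast_nonneg n
    linarith
  by_cases hρz : ρ = 0
  · -- trivial case: the left-hand side vanishes
    refine ⟨0, ?_⟩
    rw [hρz, zero_pow (Nat.succ_ne_zero _)]
    exact mul_nonneg (mul_nonneg (Nat.cast_nonneg _) (pow_nonneg (by linarith) _))
      (permCorrSq_nonneg _)
  · have hρpos : 0 < ρ := lt_of_le_of_ne hρ0 (Ne.symm hρz)
    -- amplification parameter `k = ⌈2/ρ⌉`
    set k : ℕ := ⌈(2 : ℝ) / ρ⌉₊ with hk
    have h2ρ : (0 : ℝ) < 2 / ρ := by positivity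
    have hk1 : 1 ≤ k := Nat.one_le_iff_ne_zero.2 (Nat.pos_iff_ne_zero.1 (Nat.ceil_pos.2 h2ρ))
    have hk2 : (2 : ℝ) / ρ ≤ k := Nat.le_ceil _
    have hk3 : (k : ℝ) ≤ 2 / ρ + 1 := (Nat.ceil_lt_add_one h2ρ.le).le
    obtain ⟨R', hR', K₁, κ₁, hineq⟩ := hamp n R K κ k hk1
    set ρ₁ : ℝ := permCorrSq n (PM(n, R', K₁, κ₁)) with hρ₁
    have hρ₁1 : ρ₁ ≤ 1 := permCorrSq_le_one _
    -- the amplified form is a good correlator: `ρ₁ ≥ 1/2`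
    have hkρ : (2 : ℝ) ≤ (k : ℝ) * ρ := by
      have := mul_le_mul_of_nonneg_right hk2 hρ0
      rwa [div_mul_cancel₀ _ hρz] at this
    have hgoodρ₁ : (1 / 2 : ℝ) ≤ ρ₁ := by
      have h1 : (k : ℝ) * ρ * (1 - ρ₁) ≤ 1 := le_trans hineq (by linarith)
      have h2 : 2 * (1 - ρ₁) ≤ (k : ℝ) * ρ * (1 - ρ₁) :=
        mul_le_mul_of_nonneg_right hkρ (by linarith)
      linarith
    obtain ⟨K', hK'⟩ := hgood n R' K₁ κ₁ hgoodρ₁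
    refine ⟨K', ?_⟩
    set f : ℝ := permCorrSq n (FF(n, K')) with hf
    have hf0 : 0 ≤ f := permCorrSq_nonneg _
    -- bookkeeping quantities
    set X : ℝ := (R : ℝ) + n + 2 with hX
    set T : ℝ := (k : ℝ) * X with hT
    have hX1 : (1 : ℝ) ≤ X := by linarith
    have hX0 : (0 : ℝ) ≤ X := by linarith
    have hk1r : (1 : ℝ) ≤ k := by exact_mod_cast hk1
    have hT1 : (1 : ℝ) ≤ T := by
      calc (1 : ℝ) = 1 * 1 := (mul_one 1).symm
        _ ≤ (k : ℝ) * X := mul_le_mul hk1r hX1 zero_le_one (by linarith)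
    have hTB : (1 : ℝ) ≤ T ^ B := one_le_pow₀ hT1
    have hR'le : (R' : ℝ) ≤ T ^ B := by
      have : ((R' : ℕ) : ℝ) ≤ (((k * (R + n + 2)) ^ B : ℕ) : ℝ) := by exact_mod_cast hR'
      simpa [hT, hX] using this
    -- (i) `R' + n + 1 ≤ T^B · X`
    have h_i : (R' : ℝ) + n + 1 ≤ T ^ B * X := by
      have hn0 : (0 : ℝ) ≤ n := Nat.cast_nonneg n
      have hR0 : (0 : ℝ) ≤ R := Nat.cast_nonneg R
      have hTB0 : (0 : ℝ) ≤ T ^ B := by linarith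
      calc (R' : ℝ) + n + 1 ≤ T ^ B + (n + 1) := by linarith
        _ ≤ T ^ B + T ^ B * (n + 1) + T ^ B * R := by nlinarith
        _ = T ^ B * X := by rw [hX]; ring
    -- (ii) `ρ · T ≤ 3 · X`
    have h_ii : ρ * T ≤ 3 * X := by
      have hρk : ρ * k ≤ 3 := by
        calc ρ * k ≤ ρ * (2 / ρ + 1) := mul_le_mul_of_nonneg_left hk3 hρ0
          _ = 2 + ρ := by field_simp
          _ ≤ 3 := by linarith
      calc ρ * T = ρ * k * X := by rw [hT]; ring
        _ ≤ 3 * X := mul_le_mul_of_nonneg_right hρk hX0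
    -- (iii) `ρ^B · (R' + n + 1) ≤ 3^B · X^(B+1)`
    have h_iii : ρ ^ B * ((R' : ℝ) + n + 1) ≤ (3 : ℝ) ^ B * X ^ (B + 1) := by
      calc ρ ^ B * ((R' : ℝ) + n + 1) ≤ ρ ^ B * (T ^ B * X) :=
            mul_le_mul_of_nonneg_left h_i (pow_nonneg hρ0 B)
        _ = (ρ * T) ^ B * X := by ring
        _ ≤ (3 * X) ^ B * X :=
            mul_le_mul_of_nonneg_right (pow_le_pow_left₀ (by positivity) h_ii B) hX0
        _ = (3 : ℝ) ^ B * X ^ (B + 1) := by ring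
    -- (iv) raise to the power `C₁`
    have h_iv : ρ ^ (B * C₁) * ((R' : ℝ) + n + 1) ^ C₁ ≤ (3 : ℝ) ^ (B * C₁) * X ^ ((B + 1) * C₁) := by
      have hnn : 0 ≤ ρ ^ B * ((R' : ℝ) + n + 1) := mul_nonneg (pow_nonneg hρ0 B) (by positivity)
      calc ρ ^ (B * C₁) * ((R' : ℝ) + n + 1) ^ C₁ = (ρ ^ B * ((R' : ℝ) + n + 1)) ^ C₁ := by
            rw [mul_pow, ← pow_mul]
        _ ≤ ((3 : ℝ) ^ B * X ^ (B + 1)) ^ C₁ := pow_le_pow_left₀ hnn h_iii C₁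
        _ = (3 : ℝ) ^ (B * C₁) * X ^ ((B + 1) * C₁) := by
            rw [mul_pow, ← pow_mul, ← pow_mul]
    -- (v) unwind the comparison
    have h_v : ρ ^ (B * C₁) ≤ (C₁ : ℝ) * (3 : ℝ) ^ (B * C₁) * X ^ ((B + 1) * C₁) * f := by
      have hρBC : 0 ≤ ρ ^ (B * C₁) := pow_nonneg hρ0 _
      calc ρ ^ (B * C₁) = ρ ^ (B * C₁) * 1 := (mul_one _).symm
        _ ≤ ρ ^ (B * C₁) * ((C₁ : ℝ) * ((R' : ℝ) + n + 1) ^ C₁ * f) :=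
            mul_le_mul_of_nonneg_left hK' hρBC
        _ = (C₁ : ℝ) * (ρ ^ (B * C₁) * ((R' : ℝ) + n + 1) ^ C₁) * f := by ring
        _ ≤ (C₁ : ℝ) * ((3 : ℝ) ^ (B * C₁) * X ^ ((B + 1) * C₁)) * f := by
            apply mul_le_mul_of_nonneg_right _ hf0
            exact mul_le_mul_of_nonneg_left h_iv (Nat.cast_nonneg _)
        _ = (C₁ : ℝ) * (3 : ℝ) ^ (B * C₁) * X ^ ((B + 1) * C₁) * f := by ring
    -- (vi) `X ≤ 2 (R + n + 1)` and the final constants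
    have h_vi : X ^ ((B + 1) * C₁) ≤ (2 : ℝ) ^ ((B + 1) * C₁) * ((R : ℝ) + n + 1) ^ ((B + 1) * C₁) := by
      rw [← mul_pow]
      exact pow_le_pow_left₀ hX0 (by rw [hX]; linarith) _
    have hconst : (C₁ : ℝ) * (3 : ℝ) ^ (B * C₁) * (2 : ℝ) ^ ((B + 1) * C₁) ≤ C₀ := by
      have : C₁ * 3 ^ (B * C₁) * 2 ^ ((B + 1) * C₁) ≤ C₀ := by rw [hC₀]; omega
      exact_mod_cast this
    have hexp : ((R : ℝ) + n + 1) ^ ((B + 1) * C₁) ≤ ((R : ℝ) + n + 1) ^ C₀ :=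
      pow_le_pow_right₀ hbase1 (by rw [hC₀]; omega)
    calc ρ ^ (B * C₁ + 1) ≤ ρ ^ (B * C₁) := pow_le_pow_of_le_one hρ0 hρ1 (Nat.le_succ _)
      _ ≤ (C₁ : ℝ) * (3 : ℝ) ^ (B * C₁) * X ^ ((B + 1) * C₁) * f := h_v
      _ ≤ (C₁ : ℝ) * (3 : ℝ) ^ (B * C₁) *
            ((2 : ℝ) ^ ((B + 1) * C₁) * ((R : ℝ) + n + 1) ^ ((B + 1) * C₁)) * f := by
          apply mul_le_mul_of_nonneg_right _ hf0
          exact mul_le_mul_of_nonneg_left h_vi (by positivity)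
      _ = ((C₁ : ℝ) * (3 : ℝ) ^ (B * C₁) * (2 : ℝ) ^ ((B + 1) * C₁)) *
            ((R : ℝ) + n + 1) ^ ((B + 1) * C₁) * f := by ring
      _ ≤ (C₀ : ℝ) * ((R : ℝ) + n + 1) ^ C₀ * f := by
          apply mul_le_mul_of_nonneg_right _ hf0
          exact mul_le_mul hconst hexp (by positivity) (Nat.cast_nonneg _)

end Summit.ValiantsHypothesis.ValiantsHypothesis.Cruxes.PMCorrelationGap.AmplificationLine
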